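import Summits.Ventures.HodgeRepro2.T5WeightProjectorSum

/-!
# The K-type projector is self-adjoint: orthogonality of the isotypic components

Tier-5 support (N4.3 = (R3), steps (P2′) / (P3): «Schur orthogonality cross-check», the
orthogonality of distinct `K`-types; route/T5-SUPPORT-p1.md §S4.9–§S4.11).  For a compact
Hausdorff group `G`, a probability measure `μ` invariant under left / right translations and
inversion (e.g. `haarProb G`, `T5HaarUniqueCompact`), a continuous UNITARY finite-dimensional `π`
and a continuous irreducible `σ`:

* `inner_charProj_left`: the `K`-type projector `P_σ = dim σ · ∫ conj χ_σ(g) π(g) dg` is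
  self-adjoint, `⟪P_σ v, w⟫ = ⟪v, P_σ w⟫` (unitarity of `π`, inversion invariance of `μ` and
  `χ_σ(g⁻¹) = conj χ_σ(g)`);
* `isOrtho_isotypic`: distinct isotypic components are orthogonal, `isotypic π σ ⟂ isotypic π τ`
  for `τ ≄ σ`;
* `charProj_eq_starProjection`: `P_σ` IS the orthogonal projection (Mathlib's `starProjection`)
  onto the `σ`-isotypic component.

What this file does NOT say: anything about the infinite-dimensional `π₃⁺` ([C] in N4.3).

Blind lane: Mathlib + own prefix; no sorry; axioms ⊆ {propext, Classical.choice, Quot.sound}.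
-/

namespace Summit.Ventures.HodgeRepro2.T5KTypeProjectorAdjoint

open MeasureTheory
open Summit.Ventures.HodgeRepro2.T5SchurOrthogonality Summit.Ventures.HodgeRepro2.T5SchurMathlib
  Summit.Ventures.HodgeRepro2.T5KTypeProjector Summit.Ventures.HodgeRepro2.T5IsotypicCopies
  Summit.Ventures.HodgeRepro2.T5CharacterBasics Summit.Ventures.HodgeRepro2.T5WeightProjectorSum

variable {G : Type*} [Group G] [TopologicalSpace G] [IsTopologicalGroup G] [MeasurableSpace G]
  [BorelSpace G] [CompactSpace G]
variable {V : Type*} [NormedAddCommGroup V] [InnerProductSpace ℂ V] [FiniteDimensional ℂ V]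
variable {W₀ W₁ : Type*} [NormedAddCommGroup W₀] [InnerProductSpace ℂ W₀] [FiniteDimensional ℂ W₀]
  [NormedAddCommGroup W₁] [InnerProductSpace ℂ W₁] [FiniteDimensional ℂ W₁]
variable (μ : Measure G) [IsProbabilityMeasure μ] [μ.IsMulLeftInvariant] [μ.IsMulRightInvariant]
  [μ.IsInvInvariant] [μ.IsOpenPosMeasure]
variable (π : G →* V →L[ℂ] V) (σ : G →* W₀ →L[ℂ] W₀) (τ : G →* W₁ →L[ℂ] W₁)

omit [TopologicalSpace G] [IsTopologicalGroup G] [MeasurableSpace G] [BorelSpace G]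
  [CompactSpace G] [FiniteDimensional ℂ V] in
/-- For a unitary representation, `⟪π g v, w⟫ = ⟪v, π g⁻¹ w⟫`. -/
lemma inner_apply_left_of_isUnitary (hπu : IsUnitary π) (g : G) (v w : V) :
    inner ℂ (π g v) w = inner ℂ v (π g⁻¹ w) := by
  have h := hπu g v (π g⁻¹ w)
  have hw : π g (π g⁻¹ w) = w := by
    have : π g (π g⁻¹ w) = π (g * g⁻¹) w := by rw [map_mul]; rfl
    rw [this, mul_inv_cancel, map_one]
    rfl
  rw [hw] at h
  exact h

omit [μ.IsMulRightInvariant] in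
/-- **Self-adjointness** of the `K`-type projector for a unitary representation. -/
theorem inner_charProj_left (hπ : Continuous π) (hσ : Continuous σ) (hπu : IsUnitary π)
    (v w : V) :
    inner ℂ (charProj μ π σ hπ hσ v) w = inner ℂ v (charProj μ π σ hπ hσ w) := by
  haveI := FiniteDimensional.complete ℂ V
  rw [charProj_apply, charProj_apply, inner_smul_left, inner_smul_right, map_natCast]
  congr 1
  rw [← integral_inner (integrable_charProj μ π σ hπ hσ w), ← inner_conj_symm,
    ← integral_inner (integrable_charProj μ π σ hπ hσ v), ← integral_conj]
  calc ∫ g, (starRingEnd ℂ) (inner ℂ w ((starRingEnd ℂ) (character σ g) • π g v)) ∂μ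
      = ∫ g, character σ g * inner ℂ v (π g⁻¹ w) ∂μ := by
        refine integral_congr_ae (Filter.Eventually.of_forall fun g => ?_)
        dsimp only
        rw [inner_smul_right, map_mul, Complex.conj_conj, inner_conj_symm,
          inner_apply_left_of_isUnitary π hπu]
    _ = ∫ g, character σ g⁻¹ * inner ℂ v (π g w) ∂μ := by
        rw [← integral_inv_eq_self (fun g => character σ g⁻¹ * inner ℂ v (π g w)) μ]
        simp only [inv_inv]
    _ = ∫ g, inner ℂ v ((starRingEnd ℂ) (character σ g) • π g w) ∂μ := by
        refine integral_congr_ae (Filter.Eventually.of_forall fun g => ?_)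
        dsimp only
        rw [character_inv μ σ hσ g, inner_smul_right]

omit [FiniteDimensional ℂ W₁] in
include μ in
/-- **Orthogonality of the isotypic components**: `isotypic π σ ⟂ isotypic π τ` for `τ ≄ σ`
(unitary `π`, irreducible `σ`). -/
theorem isOrtho_isotypic (hπ : Continuous π) (hσ : Continuous σ) (hπu : IsUnitary π)
    (hσi : IsIrreducible σ) [Nontrivial W₀] (hne : IsEmpty ((toRep σ).Equiv (toRep τ))) :
    (isotypic π σ) ⟂ (isotypic π τ) := by
  rw [Submodule.isOrtho_iff_inner_eq]
  intro v hv w hw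
  rw [← charProj_apply_of_mem_isotypic μ π σ hπ hσ hσi hv, inner_charProj_left μ π σ hπ hσ hπu,
    charProj_apply_eq_zero_of_mem_isotypic μ π σ τ hπ hσ hσi hne hw, inner_zero_right]

/-- **The `K`-type projector is the orthogonal projection** onto the `σ`-isotypic component. -/
theorem charProj_eq_starProjection (hπ : Continuous π) (hσ : Continuous σ)
    (hπu : IsUnitary π) (hσi : IsIrreducible σ) [Nontrivial W₀] (v : V) :
    (isotypic π σ).starProjection v = charProj μ π σ hπ hσ v := by
  refine Submodule.eq_starProjection_of_mem_of_inner_eq_zero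
    (charProj_apply_mem_isotypic μ π σ hπ hσ hσi v) fun w hw => ?_
  rw [inner_sub_left, inner_charProj_left μ π σ hπ hσ hπu,
    charProj_apply_of_mem_isotypic μ π σ hπ hσ hσi hw, sub_self]

end Summit.Ventures.HodgeRepro2.T5KTypeProjectorAdjoint
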